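import Literature.Analysis.FluidPDE.ExtremeGrowthBounds
import Literature.Analysis.FluidPDE.TorusClassicalLerayHopfProofs
import Mathlib.MeasureTheory.Integral.IntervalIntegral.FundThmCalculus
import Mathlib.Analysis.SpecialFunctions.ExpDeriv
import Mathlib.Analysis.Calculus.MeanValue
import HarnessLib

/-!
# Extreme growth — the elementary `‖ω‖_∞` control of the enstrophy (Navier–Stokes AND Euler on `T³`)

The quantitative half of the Beale–Kato–Majda mechanism at the `H¹` level, as used to audit every
optimiser / DNS trajectory of the fluid-computer experiment (BOUNDS.md §3.6, key
`b_bkm_gronwall_ratio`): along a classical solution of the unforced Navier–Stokes (`ν ≥ 0`, so Euler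
included) equations on the unit 3-torus,

`dℰ/dt = ∫ ω·(ω·∇)u − ν‖∇ω‖₂² ≤ ‖ω(t)‖_∞ ‖ω(t)‖₂² = 2‖ω(t)‖_∞ ℰ(t)`

(Doering–Gibbon 1995, eq. (6.5.18): `|∫ ω·[ω·∇u]| ≤ ‖ω‖_∞‖ω‖₂²`, using `‖∇u‖₂ = ‖ω‖₂` on the
periodic box), hence (Grönwall) `ℰ(t) ≤ ℰ(a) exp(2∫ₐᵗ ‖ω‖_∞)`, i.e.
`ln(ℰ(t)/ℰ(a)) ≤ 2∫ₐᵗ‖ω‖_∞` — finite `∫‖ω‖_∞` forbids enstrophy blow-up (the easy direction of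
Beale–Kato–Majda 1984 / Majda–Bertozzi Thm. 4.3 for `ℝ³`, here on `T³` at the enstrophy level).

* `torusVorticitySqAt v x` — the squared vorticity magnitude `|ω(x)|² = ½ ∑ᵢⱼ (∂ᵢvⱼ − ∂ⱼvᵢ)²`,
  stated WITHOUT an orientation / cross product (valid in any dimension; in `d = 3` it is
  `|∇ × v (x)|²`), over the tree's `Torus.partialDeriv`.
* `DoeringGibbon1995_enstrophyRate_le_vorticitySup` — the instantaneous estimate as a NAMED FACT
  (hypothesis `(h : …)`), in the shape of `LuDoering2008_enstrophyRate_le`: every one-sided derivative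
  value `R` of `t ↦ ℰ(u t)` within `[a, b]` obeys `R ≤ 2 M ℰ(u t)` whenever `|ω(t, ·)| ≤ M` pointwise.
  The supremum is replaced by an arbitrary pointwise majorant `M ≥ 0` (no `⨆` junk values).
* `le_mul_exp_integral_of_hasDerivWithinAt_le_mul` — the real-variable differential Grönwall lemma
  with a continuous time-dependent coefficient, PROVED: `f' ≤ k f` within `[a, b]` ⇒
  `f(t) ≤ f(a) exp(∫ₐᵗ k)`.
* `torusVorticitySqAt_le_two_mul_sum_norm_sq` — pointwise `|ω|² ≤ 2∑ᵢ‖∂ᵢv‖²` (proved).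
* `torusEnstrophy_le_mul_exp_integral_vorticityBound` (+ `…_euler`, the `ν = 0` case) — the corollary under the named fact:
  `ℰ(u t) ≤ ℰ(u a) · exp(2 ∫ₐᵗ M)` for any continuous pointwise vorticity majorant `M(s)`.

Deliberately NOT here: the proof of the named fact (it is the pointwise inequality
`|ω·(ω·∇)u| ≤ |ω|²|∇u|`, Cauchy–Schwarz and `‖∇u‖₂ = ‖ω‖₂ = √(2ℰ)` for divergence-free periodic
fields — routine 3D vector calculus over `Torus.partialDeriv`, left as a fact like the Lu–Doering
estimate), and the `ℝ³` BKM criterion itself (`Literature.Analysis.FluidPDE.VorticityDynamics`,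
`beale_kato_majda_holds`).
-/

noncomputable section

open Set MeasureTheory intervalIntegral
open scoped InnerProductSpace RealInnerProductSpace Topology

namespace Literature.Analysis.FluidPDE

open Literature.Analysis.FunctionSpaces

variable {d : Type*} [Fintype d] [DecidableEq d]

/-! ## The orientation-free squared vorticity magnitude -/

/-- The squared vorticity magnitude of a velocity field on the torus at a point,
`|ω(x)|² := ½ ∑ᵢ ∑ⱼ (∂ᵢvⱼ(x) − ∂ⱼvᵢ(x))²` — half the squared Frobenius norm of the antisymmetric
part `∇v − ∇vᵀ`; for `Fintype.card d = 3` this is `|∇ × v (x)|²` since the three vorticity components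
are exactly the entries `∂₂v₃ − ∂₃v₂, ∂₃v₁ − ∂₁v₃, ∂₁v₂ − ∂₂v₁` (Majda–Bertozzi 2002, §1.4, (1.31);
Doering–Gibbon 1995, §1.2). Junk value `0` where `v` is not differentiable (`Torus.partialDeriv`).
[cite: MajdaBertozziCUP2002, §1.4 eq. (1.31)] -/
def torusVorticitySqAt (v : UnitAddTorus d → EuclideanSpace ℝ d) (x : UnitAddTorus d) : ℝ :=
  2⁻¹ * ∑ i, ∑ j, ((Torus.partialDeriv i v x) j - (Torus.partialDeriv j v x) i) ^ 2

/-- `|ω(x)|² ≥ 0`. [folklore] -/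
theorem torusVorticitySqAt_nonneg (v : UnitAddTorus d → EuclideanSpace ℝ d) (x : UnitAddTorus d) :
    0 ≤ torusVorticitySqAt v x :=
  mul_nonneg (by norm_num) (Finset.sum_nonneg fun _ _ => Finset.sum_nonneg fun _ _ => sq_nonneg _)

/-- **Pointwise, `|ω|² ≤ 2|∇v|²_F`:** `torusVorticitySqAt v x ≤ 2 ∑ᵢ ‖∂ᵢ v (x)‖²` — from
`(a − b)² ≤ 2a² + 2b²`; so any pointwise gradient bound is a vorticity majorant `M` for the named fact
below (and, integrated, `∫|ω|² ≤ 4ℰ`; the sharp `∫|ω|² = 2ℰ` for divergence-free fields needs an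
integration by parts not done here). [folklore] -/
theorem torusVorticitySqAt_le_two_mul_sum_norm_sq (v : UnitAddTorus d → EuclideanSpace ℝ d)
    (x : UnitAddTorus d) :
    torusVorticitySqAt v x ≤ 2 * ∑ i, ‖Torus.partialDeriv i v x‖ ^ 2 := by
  set a : d → d → ℝ := fun i j => (Torus.partialDeriv i v x) j with ha
  have key : ∀ i j, (a i j - a j i) ^ 2 ≤ 2 * a i j ^ 2 + 2 * a j i ^ 2 := by
    intro i j; nlinarith [sq_nonneg (a i j + a j i)]
  have hnorm : ∀ i, ‖Torus.partialDeriv i v x‖ ^ 2 = ∑ j, a i j ^ 2 := by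
    intro i
    rw [EuclideanSpace.norm_sq_eq]
    refine Finset.sum_congr rfl fun j _ => ?_
    rw [Real.norm_eq_abs, sq_abs]
  have hsum : ∑ i, ∑ j, (2 * a i j ^ 2 + 2 * a j i ^ 2) = 4 * ∑ i, ∑ j, a i j ^ 2 := by
    have hc : ∑ i, ∑ j, a j i ^ 2 = ∑ i, ∑ j, a i j ^ 2 := Finset.sum_comm
    simp only [Finset.sum_add_distrib, ← Finset.mul_sum, hc]
    ring
  have h1 : torusVorticitySqAt v x = 2⁻¹ * ∑ i, ∑ j, (a i j - a j i) ^ 2 := by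
    simp only [torusVorticitySqAt, ha]
  rw [h1]
  calc 2⁻¹ * ∑ i, ∑ j, (a i j - a j i) ^ 2
      ≤ 2⁻¹ * ∑ i, ∑ j, (2 * a i j ^ 2 + 2 * a j i ^ 2) := by
        gcongr with i _ j _
        exact key i j
    _ = 2 * ∑ i, ∑ j, a i j ^ 2 := by rw [hsum]; ring
    _ = 2 * ∑ i, ‖Torus.partialDeriv i v x‖ ^ 2 := by simp only [hnorm]

/-! ## The instantaneous estimate (named fact) -/

/-- **`‖ω‖_∞` controls the enstrophy rate (Doering–Gibbon 1995, (6.5.18); named fact).** On the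
unit 3-torus (`Fintype.card d = 3`), for every `ν ≥ 0` (Navier–Stokes, and Euler at `ν = 0`) and
every classical solution `(u, p)` of the UNFORCED system on `[a, b]`, `a < b`: if at time
`t ∈ [a, b]` the vorticity is pointwise bounded, `|ω(t, x)|² ≤ M²` for all `x` with `0 ≤ M`, then
every one-sided derivative value `R` of the enstrophy `s ↦ ℰ(u s) = ½‖∇u(s)‖₂²` within `[a, b]` at
`t` satisfies `R ≤ 2 M ℰ(u t)` — from `dℰ/dt = ∫ω·(ω·∇)u − ν‖∇ω‖₂²`,
`|∫ω·(ω·∇)u| ≤ ‖ω‖_∞‖ω‖₂‖∇u‖₂ = ‖ω‖_∞‖ω‖₂²` and `‖ω‖₂² = ‖∇u‖₂² = 2ℰ` for divergence-free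
periodic fields. The derivative exists (`Torus.IsClassicalNSSolutionOn.hasDerivWithinAt_half_gradNormSq`),
so the statement is not vacuous; `M` is any pointwise majorant (no supremum, no junk value).
[cite: DoeringGibbon1995, §6.5 eq. (6.5.18) (p. 110)] -/
def DoeringGibbon1995_enstrophyRate_le_vorticitySup : Prop :=
  Fintype.card d = 3 → ∀ {ν : ℝ}, 0 ≤ ν → ∀ {a b : ℝ}, a < b →
    ∀ {u : ℝ → UnitAddTorus d → EuclideanSpace ℝ d} {p : ℝ → UnitAddTorus d → ℝ},
      Torus.IsClassicalNSSolutionOn (Icc a b) ν 0 u p →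
      ∀ t ∈ Icc a b, ∀ M : ℝ, 0 ≤ M → (∀ x, torusVorticitySqAt (u t) x ≤ M ^ 2) →
        ∀ R : ℝ, HasDerivWithinAt (fun s => torusEnstrophy (u s)) R (Icc a b) t →
          R ≤ 2 * M * torusEnstrophy (u t)

/-! ## Differential Grönwall with a continuous coefficient (proved) -/

omit [Fintype d] [DecidableEq d] in
/-- **Differential Grönwall inequality, variable continuous coefficient.** If `f` has one-sided
derivative `f'(s)` within `[a, b]` at every `s ∈ [a, b]`, `k` is continuous on `[a, b]` and
`f'(s) ≤ k(s) f(s)` on `[a, b]`, then `f(t) ≤ f(a) · exp(∫ₐᵗ k)` for every `t ∈ [a, b]`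
(no sign condition on `f`: `s ↦ f(s) exp(−∫ₐˢ k)` is non-increasing). [folklore] -/
theorem le_mul_exp_integral_of_hasDerivWithinAt_le_mul {a b : ℝ} (hab : a < b) {f f' k : ℝ → ℝ}
    (hder : ∀ s ∈ Icc a b, HasDerivWithinAt f (f' s) (Icc a b) s)
    (hk : ContinuousOn k (Icc a b)) (hle : ∀ s ∈ Icc a b, f' s ≤ k s * f s)
    {t : ℝ} (ht : t ∈ Icc a b) :
    f t ≤ f a * Real.exp (∫ s in a..t, k s) := by
  -- the primitive `K s = ∫ₐˢ k` and its derivative within `[a, b]`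
  set K : ℝ → ℝ := fun s => ∫ r in a..s, k r with hKdef
  have hK : ∀ s ∈ Icc a b, HasDerivWithinAt K (k s) (Icc a b) s := by
    intro s hs
    haveI : Fact (s ∈ Icc a b) := ⟨hs⟩
    have hint : IntervalIntegrable k volume a s :=
      (hk.mono (Icc_subset_Icc_right hs.2)).intervalIntegrable_of_Icc hs.1
    exact integral_hasDerivWithinAt_right hint
      (hk.stronglyMeasurableAtFilter_nhdsWithin measurableSet_Icc s) (hk s hs)
  -- `g s = f s · exp(−K s)` is non-increasing on `[a, b]`
  set g : ℝ → ℝ := fun s => f s * Real.exp (-K s) with hgdef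
  set g' : ℝ → ℝ := fun s => f' s * Real.exp (-K s) + f s * (Real.exp (-K s) * -k s) with hg'def
  have hg : ∀ s ∈ Icc a b, HasDerivWithinAt g (g' s) (Icc a b) s := fun s hs =>
    (hder s hs).mul ((hK s hs).neg.exp)
  have hg'le : ∀ s ∈ Icc a b, g' s ≤ 0 := by
    intro s hs
    have he : 0 < Real.exp (-K s) := Real.exp_pos _
    have : g' s = Real.exp (-K s) * (f' s - k s * f s) := by rw [hg'def]; ring
    rw [this]
    exact mul_nonpos_of_nonneg_of_nonpos he.le (sub_nonpos.2 (hle s hs))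
  have hanti : AntitoneOn g (Icc a b) := by
    refine antitoneOn_of_hasDerivWithinAt_nonpos (convex_Icc a b)
      (fun s hs => (hg s hs).continuousWithinAt) (f' := g') ?_ ?_
    · intro s hs
      rw [interior_Icc] at hs ⊢
      exact (hg s (Ioo_subset_Icc_self hs)).mono Ioo_subset_Icc_self
    · intro s hs
      rw [interior_Icc] at hs
      exact hg'le s (Ioo_subset_Icc_self hs)
  have hKa : K a = 0 := by rw [hKdef]; exact integral_same
  have hga : g a = f a := by rw [hgdef]; simp only [hKa, neg_zero, Real.exp_zero, mul_one]
  have hgt : g t ≤ g a := hanti (left_mem_Icc.2 hab.le) ht ht.1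
  have he : 0 < Real.exp (K t) := Real.exp_pos _
  have hft : f t = g t * Real.exp (K t) := by
    rw [hgdef]; simp only []
    rw [mul_assoc, ← Real.exp_add, neg_add_cancel, Real.exp_zero, mul_one]
  calc f t = g t * Real.exp (K t) := hft
    _ ≤ g a * Real.exp (K t) := mul_le_mul_of_nonneg_right hgt he.le
    _ = f a * Real.exp (∫ s in a..t, k s) := by rw [hga]

/-! ## The finite-time corollary on the torus -/

/-- **Enstrophy is controlled by the time integral of `‖ω‖_∞` (Grönwall form of Doering–Gibbon
(6.5.18); the `H¹`-level Beale–Kato–Majda bookkeeping).** Under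
`DoeringGibbon1995_enstrophyRate_le_vorticitySup`: along a classical solution of the unforced
Navier–Stokes equations with `ν ≥ 0` (Euler included) on `T³ × [a, b]`, if `M : ℝ → ℝ` is a continuous
pointwise majorant of the vorticity magnitude on `[a, b]` (`|ω(s, x)|² ≤ M(s)²`, `0 ≤ M(s)`), then
`ℰ(u t) ≤ ℰ(u a) · exp(2 ∫ₐᵗ M)` for all `t ∈ [a, b]`; equivalently `ln(ℰ(t)/ℰ(a)) ≤ 2∫ₐᵗ M`
(the per-run check `b_bkm_gronwall_ratio ≤ 1` of the fluid-computer analysis). In particular a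
finite `∫ₐᵀ ‖ω‖_∞` keeps the enstrophy bounded up to `T`.
[cite: DoeringGibbon1995, §6.5 eqs. (6.5.18)–(6.5.19) (p. 110)] -/
theorem torusEnstrophy_le_mul_exp_integral_vorticityBound
    (hDG : DoeringGibbon1995_enstrophyRate_le_vorticitySup (d := d)) (hd : Fintype.card d = 3)
    {ν a b : ℝ} (hν : 0 ≤ ν) (hab : a < b)
    {u : ℝ → UnitAddTorus d → EuclideanSpace ℝ d} {p : ℝ → UnitAddTorus d → ℝ}
    (h : Torus.IsClassicalNSSolutionOn (Icc a b) ν 0 u p)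
    {M : ℝ → ℝ} (hMc : ContinuousOn M (Icc a b)) (hM0 : ∀ s ∈ Icc a b, 0 ≤ M s)
    (hω : ∀ s ∈ Icc a b, ∀ x, torusVorticitySqAt (u s) x ≤ M s ^ 2) {t : ℝ} (ht : t ∈ Icc a b) :
    torusEnstrophy (u t) ≤ torusEnstrophy (u a) * Real.exp (2 * ∫ s in a..t, M s) := by
  set F : ℝ → ℝ := fun s => -ν * (∫ x, ‖Torus.laplacian (u s) x‖ ^ 2) +
      ∫ x, ⟪Torus.convect (u s) (u s) x - (0 : ℝ → UnitAddTorus d → EuclideanSpace ℝ d) s x,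
        Torus.laplacian (u s) x⟫ with hF
  have hder : ∀ s ∈ Icc a b,
      HasDerivWithinAt (fun r => torusEnstrophy (u r)) (F s) (Icc a b) s :=
    fun s hs => h.hasDerivWithinAt_half_gradNormSq hab hs
  have hle : ∀ s ∈ Icc a b, F s ≤ (2 * M s) * torusEnstrophy (u s) :=
    fun s hs => hDG hd hν hab h s hs (M s) (hM0 s hs) (hω s hs) (F s) (hder s hs)
  have hk : ContinuousOn (fun s => 2 * M s) (Icc a b) := continuousOn_const.mul hMc
  have hmain := le_mul_exp_integral_of_hasDerivWithinAt_le_mul hab hder hk hle ht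
  rwa [intervalIntegral.integral_const_mul] at hmain

/-- **The Euler case (`ν = 0`) of the `‖ω‖_∞`-Grönwall control, stated separately** (the instruction's
"Euler analogue": there is no `ℰ³`-type bound for Euler, this is the only rigorous per-run enstrophy
check of an Euler campaign): along a classical solution of the unforced incompressible EULER equations
on `T³ × [a, b]` (`Torus.IsClassicalNSSolutionOn (Icc a b) 0 0 u p`), a continuous pointwise vorticity
majorant `M ≥ 0` gives `ℰ(u t) ≤ ℰ(u a) · exp(2∫ₐᵗ M)`.
[cite: DoeringGibbon1995, §6.5 eqs. (6.5.18)–(6.5.19) (p. 110)] -/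
theorem torusEnstrophy_le_mul_exp_integral_vorticityBound_euler
    (hDG : DoeringGibbon1995_enstrophyRate_le_vorticitySup (d := d)) (hd : Fintype.card d = 3)
    {a b : ℝ} (hab : a < b)
    {u : ℝ → UnitAddTorus d → EuclideanSpace ℝ d} {p : ℝ → UnitAddTorus d → ℝ}
    (h : Torus.IsClassicalNSSolutionOn (Icc a b) 0 0 u p)
    {M : ℝ → ℝ} (hMc : ContinuousOn M (Icc a b)) (hM0 : ∀ s ∈ Icc a b, 0 ≤ M s)
    (hω : ∀ s ∈ Icc a b, ∀ x, torusVorticitySqAt (u s) x ≤ M s ^ 2) {t : ℝ} (ht : t ∈ Icc a b) :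
    torusEnstrophy (u t) ≤ torusEnstrophy (u a) * Real.exp (2 * ∫ s in a..t, M s) :=
  torusEnstrophy_le_mul_exp_integral_vorticityBound hDG hd le_rfl hab h hMc hM0 hω ht


/-- **Log form = the per-run diagnostic `b_bkm_gronwall_ratio ≤ 1`.** Under the hypotheses of
`torusEnstrophy_le_mul_exp_integral_vorticityBound` and `0 < ℰ(u a)`:
`log (ℰ(u t) / ℰ(u a)) ≤ 2 ∫ₐᵗ M`, i.e. the logarithmic enstrophy amplification over `[a, t]` is at
most twice the time-integral of any continuous pointwise vorticity majorant (NS with `ν ≥ 0`, Euler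
included). This is exactly the inequality the fluid-computer analysis reports per optimiser run as
`ln(ℰ_max/ℰ₀) / (2∫₀^{t_peak} ω_max) ≤ 1`.
[cite: DoeringGibbon1995, §6.5 eqs. (6.5.18)–(6.5.19) (p. 110)] -/
theorem log_torusEnstrophy_div_le_two_mul_integral_vorticityBound
    (hDG : DoeringGibbon1995_enstrophyRate_le_vorticitySup (d := d)) (hd : Fintype.card d = 3)
    {ν a b : ℝ} (hν : 0 ≤ ν) (hab : a < b)
    {u : ℝ → UnitAddTorus d → EuclideanSpace ℝ d} {p : ℝ → UnitAddTorus d → ℝ}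
    (h : Torus.IsClassicalNSSolutionOn (Icc a b) ν 0 u p)
    {M : ℝ → ℝ} (hMc : ContinuousOn M (Icc a b)) (hM0 : ∀ s ∈ Icc a b, 0 ≤ M s)
    (hω : ∀ s ∈ Icc a b, ∀ x, torusVorticitySqAt (u s) x ≤ M s ^ 2)
    (hEa : 0 < torusEnstrophy (u a)) {t : ℝ} (ht : t ∈ Icc a b) :
    Real.log (torusEnstrophy (u t) / torusEnstrophy (u a)) ≤ 2 * ∫ s in a..t, M s := by
  have hmain := torusEnstrophy_le_mul_exp_integral_vorticityBound hDG hd hν hab h hMc hM0 hω ht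
  have hK : 0 ≤ 2 * ∫ s in a..t, M s := by
    have hI : 0 ≤ ∫ s in a..t, M s :=
      intervalIntegral.integral_nonneg ht.1 (fun s hs => hM0 s ⟨hs.1, hs.2.trans ht.2⟩)
    positivity
  rcases (torusEnstrophy_nonneg (u t)).eq_or_lt with h0 | hpos
  · rw [← h0, zero_div, Real.log_zero]
    exact hK
  · rw [Real.log_le_iff_le_exp (div_pos hpos hEa), div_le_iff₀ hEa]
    simpa [mul_comm] using hmain

/-! ### Energy identity in enstrophy units

The kinetic energy `K = ½‖u‖₂²` (`Torus.kineticEnergy`) of an unforced classical solution obeys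
`K(t) − K(s) = −2ν ∫ₛᵗ ℰ(u(τ)) dτ` with `ℰ = ½‖∇u‖₂²` (`torusEnstrophy`): the dissipation rate is
`ε = 2νℰ` (Doering–Gibbon 1995, (1.16)–(1.17); Doering–Foias 2002, (2.4)). This is the identity the
opt-bounds analysis checks along every computed extreme trajectory (`b_energy_identity_ratio = 1`). -/

/-- **Energy identity, enstrophy units**: for an unforced classical solution on a convex time set `S`
and `[s, t] ⊆ S`, `K(u(t)) − K(u(s)) = −2ν ∫ₛᵗ ℰ(u(τ)) dτ` — the integrated energy equality
`Torus.IsClassicalNSSolutionOn.energy_eq` with `f = 0` and `‖∇u‖₂² = 2ℰ`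
(Doering–Foias 2002, (2.4); Robinson–Rodrigo–Sadowski 2016, Thm. 6.5). [cite: DoeringFoias2002, (2.4)] -/
theorem kineticEnergy_sub_eq_neg_two_mul_integral_torusEnstrophy {S : Set ℝ} {ν : ℝ}
    {u : ℝ → UnitAddTorus d → EuclideanSpace ℝ d} {p : ℝ → UnitAddTorus d → ℝ}
    (h : Torus.IsClassicalNSSolutionOn S ν 0 u p) (hSc : Convex ℝ S) {s t : ℝ} (hst : s ≤ t)
    (hI : Icc s t ⊆ S) :
    Torus.kineticEnergy (u t) - Torus.kineticEnergy (u s) =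
      -(2 * ν) * ∫ τ in s..t, torusEnstrophy (u τ) := by
  have h1 := h.energy_eq hSc hst hI
  simp only [Pi.zero_apply, inner_zero_left, integral_zero, intervalIntegral.integral_zero,
    add_zero] at h1
  simp_rw [gradNormSq_eq_two_mul_torusEnstrophy] at h1
  rw [intervalIntegral.integral_const_mul] at h1
  linarith

/-- **Energy decay**: for `ν ≥ 0` the kinetic energy of an unforced classical solution is
non-increasing, `K(u(t)) ≤ K(u(s))` for `s ≤ t` (Doering–Gibbon 1995, (1.17): `dK/dt = −ε ≤ 0`).
[cite: DoeringFoias2002, (2.4)] -/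
theorem kineticEnergy_le_of_le {S : Set ℝ} {ν : ℝ} (hν : 0 ≤ ν)
    {u : ℝ → UnitAddTorus d → EuclideanSpace ℝ d} {p : ℝ → UnitAddTorus d → ℝ}
    (h : Torus.IsClassicalNSSolutionOn S ν 0 u p) (hSc : Convex ℝ S) {s t : ℝ} (hst : s ≤ t)
    (hI : Icc s t ⊆ S) :
    Torus.kineticEnergy (u t) ≤ Torus.kineticEnergy (u s) := by
  have h1 := kineticEnergy_sub_eq_neg_two_mul_integral_torusEnstrophy h hSc hst hI
  have hint : 0 ≤ ∫ τ in s..t, torusEnstrophy (u τ) :=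
    intervalIntegral.integral_nonneg hst fun τ _ => torusEnstrophy_nonneg _
  nlinarith

/-- **Energy–enstrophy budget**: the time-integrated enstrophy of an unforced classical solution with
`ν > 0` is paid for by kinetic energy, `2ν ∫ₛᵗ ℰ(u(τ)) dτ ≤ K(u(s))` (since `K(u(t)) ≥ 0`;
Doering–Gibbon 1995, (1.21): `⟨ε⟩ T ≤ K(0)`; the a-priori bound behind Leray–Hopf weak solutions).
[cite: DoeringFoias2002, (2.4)] -/
theorem two_mul_integral_torusEnstrophy_le_kineticEnergy {S : Set ℝ} {ν : ℝ}
    {u : ℝ → UnitAddTorus d → EuclideanSpace ℝ d} {p : ℝ → UnitAddTorus d → ℝ}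
    (h : Torus.IsClassicalNSSolutionOn S ν 0 u p) (hSc : Convex ℝ S) {s t : ℝ} (hst : s ≤ t)
    (hI : Icc s t ⊆ S) :
    2 * ν * ∫ τ in s..t, torusEnstrophy (u τ) ≤ Torus.kineticEnergy (u s) := by
  have h1 := kineticEnergy_sub_eq_neg_two_mul_integral_torusEnstrophy h hSc hst hI
  have hK : 0 ≤ Torus.kineticEnergy (u t) := Torus.kineticEnergy_nonneg _
  nlinarith

end Literature.Analysis.FluidPDE
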